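import Literature.MathematicalPhysics.QuantumManyBody.BoseGasDiluteEnergyFloor
import HarnessLib

/-!
# Route `BECTangentRigidity`, crux `MesoscopicFloor` (stmt-AtomisticToContinuum-13035),
# line registered (`Lines/birth.lean`): the registered stub `stub_energyCeiling`

This file proves the registered stub `stub_energyCeiling` of the birth skeleton of the crux
`MesoscopicFloor`; it supports (does not close) the item.

**Statement.** For every repulsive finite-range `v` there is `ρ₀ > 0` such that for every density
`0 < ρ < ρ₀` the Dirichlet ground-state energy of `N` bosons in the box of side
`L_N = sideLength ρ N = (N/ρ)^{1/3}` is `O(N)`: eventually `E₀^D(N, L_N) ≤ M N` for some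
`M = M(v, ρ) > 0`.

**Proof.** Take `ρ₀ := ρ₂(v)` from `exists_density_cap_tendsto_e0`: for `0 < ρ < ρ₂` the
thermodynamic-limit energy per particle `e0 v ρ` is finite and
`energyPerParticleDirichlet v ρ N = E₀^D(N, L_N)/N → e0 v ρ`. With `M := (e0 v ρ).toReal + 1`,
`e0 v ρ < ofReal M`, so eventually `E₀^D(N, L_N)/N < ofReal M`, whence
`E₀^D(N, L_N) ≤ ofReal M * N = ofReal (M * N)`.
-/

noncomputable section

open Filter
open scoped ENNReal

namespace Summit.AtomisticToContinuum.BoseEinsteinCondensation.Theorems.MesoscopicFloor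

open Literature.MathematicalPhysics.QuantumManyBody.BoseGas

/-- **Dirichlet energy ceiling in the dilute thermodynamic limit** (registered stub
`stub_energyCeiling` of the birth line of the crux `MesoscopicFloor`). For every repulsive
finite-range `v` there is `ρ₀ > 0` such that for every density `0 < ρ < ρ₀` the Dirichlet
ground-state energy of `N` bosons in the box of side `L_N = (N/ρ)^{1/3}` is `O(N)`:
`E₀^D(N, L_N) ≤ M N` for all large `N`, with `M = e₀(ρ) + 1`. Immediate from the finite,
identified thermodynamic limit `exists_density_cap_tendsto_e0`. -/
theorem stub_energyCeiling :
    ∀ v : ℝ → ℝ≥0∞, IsRepulsiveFiniteRange v → ∃ ρ₀ : ℝ, 0 < ρ₀ ∧ ∀ ρ : ℝ, 0 < ρ → ρ < ρ₀ →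
      ∃ M : ℝ, 0 < M ∧ ∀ᶠ N : ℕ in atTop,
        groundStateEnergy v N (sideLength ρ N) ≤ ENNReal.ofReal (M * N) := by
  intro v hv
  obtain ⟨ρ₂, hρ₂, hρ⟩ := exists_density_cap_tendsto_e0 v hv
  refine ⟨ρ₂, hρ₂, fun ρ hρpos hρlt => ?_⟩
  obtain ⟨he, hT, -⟩ := hρ ρ hρpos hρlt
  have hM : 0 < (e0 v ρ).toReal + 1 := by positivity
  refine ⟨(e0 v ρ).toReal + 1, hM, ?_⟩
  have hlt : e0 v ρ < ENNReal.ofReal ((e0 v ρ).toReal + 1) :=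
    (ENNReal.lt_ofReal_iff_toReal_lt he).2 (lt_add_one _)
  filter_upwards [(tendsto_order.1 hT).2 _ hlt, eventually_ne_atTop 0] with N hN hN0
  have hN0' : (N : ℝ≥0∞) ≠ 0 := Nat.cast_ne_zero.2 hN0
  have h : groundStateEnergy v N (sideLength ρ N) ≤
      ENNReal.ofReal ((e0 v ρ).toReal + 1) * N :=
    (ENNReal.div_le_iff_le_mul (Or.inl hN0') (Or.inl (ENNReal.natCast_ne_top N))).1 hN.le
  rwa [ENNReal.ofReal_mul hM.le, ENNReal.ofReal_natCast]

end Summit.AtomisticToContinuum.BoseEinsteinCondensation.Theorems.MesoscopicFloor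

end
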